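import Summits.NavierStokesRegularity.NavierStokesRegularity.Theorems.BoundedTemperatureClosed.Negative.ZeroDatumDichotomy
import Summits.NavierStokesRegularity.NavierStokesRegularity.Theorems.BoundedTemperatureClosed.Negative.BoundedTemperatureClosedFalseOfTypeIInfimumNotAttainedNS
import Summits.NavierStokesRegularity.NavierStokesRegularity.Theorems.BoundedTemperatureClosed.Negative.TemperatureFloor

/-!
# Crux `BoundedTemperatureClosed` (stmt-NavierStokesRegularity-18303), negative side:
# with the temperature floor, the zero-datum instance IS `¬ TypeIInfimumNotAttainedNS`

Negative-side support lemmas of the line lead (line `Sketch`, lead c1; `--supports`, nothing here closes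
the item). The temperature floor of `TemperatureFloor.lean` (Leray's rate in Tao's mild class:
`exists_typeIFloor`) removes the "floor" clause from the zero-datum analysis of `ZeroDatumTools` /
`ZeroDatumDichotomy` / the disprover's negative lemma, leaving exactly ONE open statement. For an averaging
datum with identically vanishing form (`exists_form_eq_zero`; segment `T_θ = θ·B`):

* `closure_btSet_subset_of_form_eq_zero` — the registered stub `stub_lossyClosed` of line `Sketch` HOLDS at
  every such datum, unconditionally: `closure S_M ⊆ S_{M+η}` for all `M` and `η > 0` (the sets are up-rays of
  `(0,1]` bounded away from the heat point `θ = 0` by `c_Leray / M`).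
* `nsDichotomy_iff_nsAttained`, `nsAttained_iff_not_typeIInfimumNotAttainedNS` — the Navier–Stokes Type-I
  dichotomy of `ZeroDatumDichotomy` ("no Schwartz-data mild Type-I blow-up, or a coldest one") is now
  equivalent to ATTAINMENT alone, i.e. to the negation of the registered open statement
  `TypeIInfimumNotAttainedNS`.
* `isClosed_btSet_iff_not_typeIInfimumNotAttainedNS` — hence at every form-zero datum the crux's closedness
  (all ceilings) is EQUIVALENT to `¬ TypeIInfimumNotAttainedNS`: the disprover's negative lemma
  `boundedTemperatureClosed_false_of_typeIInfimumNotAttainedNS` is sharp there, and the misstatement of the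
  crux as quantified (`∀ 𝒜 ∀ M`) is pinned to exactly one registered open Navier–Stokes statement.
* `attain_iff_not_typeIInfimumNotAttainedNS` — and the registered stub `stub_attain`, read at a form-zero
  datum, is that same statement: the LOSSY/ATTAIN split of line `Sketch` has no leverage at the obstruction
  (LOSSY is a theorem there, ATTAIN is the whole open problem).

## References

* J. Leray, Acta Math. 63 (1934), §19 (3.9). [Leray1934]
* T. Tao, J. Amer. Math. Soc. 29 (2016), arXiv:1402.0290v3, §1.1 (1.13), (1.15). [Tao2016AveragedNS]
* W. Rusin, V. Šverák, J. Funct. Anal. 260 (2011) = arXiv:0911.0500, §1 question (Q). [RusinSverak2011]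
-/

noncomputable section

-- the nested summit namespace `…NavierStokesRegularity.NavierStokesRegularity…` is the tree's layout
-- (D-0017), so the duplicated-namespace linter must be silenced for every declaration below
set_option linter.dupNamespace false

namespace Summit.NavierStokesRegularity.NavierStokesRegularity.Theorems.BoundedTemperatureClosed.Negative

open MeasureTheory Set Filter Topology
open scoped ENNReal
open Literature.Analysis.FluidPDE Literature.Analysis.FluidPDE.Tao2016

/-- The bounded-temperature blow-up set of the datum `𝒜` at ceiling `M` along the segment
`T_θ = (1-θ)·B̃_𝒜 + θ·B` — verbatim the set whose closedness the crux asserts. -/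
local notation3 "btSet[" 𝒜 ", " M "]" =>
  {θ : ℝ | θ ∈ Set.Icc (0 : ℝ) 1 ∧
    ∃ u₀ : SchwartzMap (EuclideanSpace ℝ (Fin 3)) (EuclideanSpace ℝ (Fin 3)),
      Literature.Analysis.FluidPDE.VectorCalculus.IsDivFree ⇑u₀ ∧ ∃ S : ℝ, 0 < S ∧
      ∃ u : ℝ → Literature.Analysis.FluidPDE.Tao2016.L2C,
        Literature.Analysis.FluidPDE.Tao2016.IsMildSolutionFor
          (fun a b c => ((1 - θ : ℝ) : ℂ) * AveragingDatum.form 𝒜 a b c +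
            ((θ : ℝ) : ℂ) * Literature.Analysis.FluidPDE.Tao2016.eulerForm a b c)
          (Literature.Analysis.FluidPDE.Tao2016.schwartzL2 u₀) (Set.Ico 0 S) u ∧
        (∀ t ∈ Set.Ico 0 S, MeasureTheory.eLpNorm (u t) ⊤ MeasureTheory.volume ≤
          ENNReal.ofReal (M / Real.sqrt (S - t))) ∧
        ¬ ∃ S' : ℝ, S < S' ∧ ∃ v : ℝ → Literature.Analysis.FluidPDE.Tao2016.L2C,
          Literature.Analysis.FluidPDE.Tao2016.IsMildSolutionFor
            (fun a b c => ((1 - θ : ℝ) : ℂ) * AveragingDatum.form 𝒜 a b c +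
              ((θ : ℝ) : ℂ) * Literature.Analysis.FluidPDE.Tao2016.eulerForm a b c)
            (Literature.Analysis.FluidPDE.Tao2016.schwartzL2 u₀) (Set.Ico 0 S') v ∧
          ∀ t ∈ Set.Ico 0 S, v t = u t}

/-- **Navier–Stokes has a Schwartz-data `H¹⁰_df`-mild Type-I blow-up at ceiling `M`** — the membership
predicate of the crux's set at the Euler end `θ = 1`. -/
local notation3 "nsTypeI[" M "]" =>
  ∃ u₀ : SchwartzMap (EuclideanSpace ℝ (Fin 3)) (EuclideanSpace ℝ (Fin 3)),
    Literature.Analysis.FluidPDE.VectorCalculus.IsDivFree ⇑u₀ ∧ ∃ S : ℝ, 0 < S ∧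
    ∃ u : ℝ → Literature.Analysis.FluidPDE.Tao2016.L2C,
      Literature.Analysis.FluidPDE.Tao2016.IsMildSolutionFor
        Literature.Analysis.FluidPDE.Tao2016.eulerForm
        (Literature.Analysis.FluidPDE.Tao2016.schwartzL2 u₀) (Set.Ico 0 S) u ∧
      (∀ t ∈ Set.Ico 0 S, MeasureTheory.eLpNorm (u t) ⊤ MeasureTheory.volume ≤
        ENNReal.ofReal (M / Real.sqrt (S - t))) ∧
      ¬ ∃ S' : ℝ, S < S' ∧ ∃ v : ℝ → Literature.Analysis.FluidPDE.Tao2016.L2C,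
        Literature.Analysis.FluidPDE.Tao2016.IsMildSolutionFor
          Literature.Analysis.FluidPDE.Tao2016.eulerForm
          (Literature.Analysis.FluidPDE.Tao2016.schwartzL2 u₀) (Set.Ico 0 S') v ∧
        ∀ t ∈ Set.Ico 0 S, v t = u t

/-- **The Navier–Stokes Type-I dichotomy** of `ZeroDatumDichotomy`: no Schwartz-data `H¹⁰_df`-mild
Type-I blow-up at any ceiling, or a coldest one. -/
local notation3 "nsDichotomy" =>
  (∀ M : ℝ, ¬ nsTypeI[M]) ∨ ∃ m : ℝ, 0 < m ∧ ∀ M : ℝ, (nsTypeI[M] ↔ m ≤ M)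

/-- **Attainment**: every positive ceiling all of whose strict upper ceilings are admissible is
admissible. -/
local notation3 "nsAttained" =>
  ∀ m : ℝ, 0 < m → (∀ M : ℝ, m < M → nsTypeI[M]) → nsTypeI[m]

/-! ### `stub_lossyClosed` holds at every form-zero datum -/

/-- With a floor `c` on the admissible ceilings, the blow-up set of a form-zero datum at a ceiling `M > 0`
keeps away from the heat point: `S_M ⊆ [c/M, 1]` (membership at `θ > 0` is `nsTypeI[θM]`, so `c ≤ θM`;
`θ = 0` is never a member). [cite: Tao2016AveragedNS, §1.1 (1.15)] -/
theorem btSet_subset_Icc_of_form_eq_zero {𝒜 : AveragingDatum} (h0 : ∀ u v w : L2C, 𝒜.form u v w = 0)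
    {c : ℝ} (hc : ∀ K : ℝ, nsTypeI[K] → c ≤ K) {M : ℝ} (hM : 0 < M) :
    btSet[𝒜, M] ⊆ Icc (c / M) 1 := by
  intro θ hθ
  rcases hθ.1.1.eq_or_lt with hz | hpos
  · exact absurd (by rwa [← hz] at hθ) (zero_not_mem_btSet_of_form_eq_zero h0 M)
  · refine ⟨(div_le_iff₀ hM).2 (hc _ ?_), hθ.1.2⟩
    exact (mem_btSet_iff_of_form_eq_zero h0 hpos hθ.1.2 M).1 hθ

/-- **Lossy closedness at a form-zero datum (the registered stub `stub_lossyClosed` of line `Sketch`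
holds there, unconditionally).** For every ceiling `M` and every `η > 0`,
`closure S_M ⊆ S_{M+η}`: for `M ≤ 0` the set is empty (cold sector); for `M > 0` it lies in
`[c_Leray/M, 1]` by the temperature floor (`exists_typeIFloor`), so a limit `θ` of members is positive, and
a member `θ'` with `θ' < θ(1 + η/M)` gives `nsTypeI[θ'M]`, hence `nsTypeI[θ(M+η)]` by monotonicity, i.e.
`θ ∈ S_{M+η}`. [cite: Leray1934, §19 (3.9)] -/
theorem closure_btSet_subset_of_form_eq_zero {𝒜 : AveragingDatum} (h0 : ∀ u v w : L2C, 𝒜.form u v w = 0)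
    (M : ℝ) {η : ℝ} (hη : 0 < η) : closure btSet[𝒜, M] ⊆ btSet[𝒜, M + η] := by
  intro θ hθ
  rcases le_or_gt M 0 with hM | hM
  · rw [btSet_eq_empty_of_nonpos 𝒜 hM, closure_empty] at hθ
    exact absurd hθ (notMem_empty θ)
  obtain ⟨c, hc, hfloor⟩ := exists_typeIFloor
  have hθI : θ ∈ Icc (c / M) 1 :=
    closure_minimal (btSet_subset_Icc_of_form_eq_zero h0 hfloor hM) isClosed_Icc hθ
  have hθpos : 0 < θ := lt_of_lt_of_le (div_pos hc hM) hθI.1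
  -- a member `θ'` within `θη/M` of `θ`
  obtain ⟨θ', hθ'mem, hdist⟩ := Metric.mem_closure_iff.1 hθ (θ * η / M) (by positivity)
  have hθ'pos : 0 < θ' := by
    rcases hθ'mem.1.1.eq_or_lt with hz | hpos
    · exact absurd (by rwa [← hz] at hθ'mem) (zero_not_mem_btSet_of_form_eq_zero h0 M)
    · exact hpos
  have hns : nsTypeI[θ' * M] := (mem_btSet_iff_of_form_eq_zero h0 hθ'pos hθ'mem.1.2 M).1 hθ'mem
  have hle : θ' * M ≤ θ * (M + η) := by
    rw [Real.dist_eq] at hdist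
    have h1 : θ' - θ < θ * η / M := (abs_sub_lt_iff.1 hdist).2
    have h2 : (θ' - θ) * M < θ * η := by
      have := mul_lt_mul_of_pos_right h1 hM
      rwa [div_mul_cancel₀ _ hM.ne'] at this
    nlinarith
  exact (mem_btSet_iff_of_form_eq_zero h0 hθpos hθI.2 (M + η)).2 (nsTypeI_mono hle hns)

/-! ### With the floor, the dichotomy is attainment, i.e. `¬ TypeIInfimumNotAttainedNS` -/

/-- **Attainment is the negation of the registered open statement `TypeIInfimumNotAttainedNS`**
(pure logic). [folklore] -/
theorem nsAttained_iff_not_typeIInfimumNotAttainedNS : nsAttained ↔ ¬ TypeIInfimumNotAttainedNS := by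
  unfold TypeIInfimumNotAttainedNS
  constructor
  · rintro h ⟨K, hK, hnot, hall⟩
    exact hnot (h K hK hall)
  · intro h K hK hall
    by_contra hnot
    exact h ⟨K, hK, hnot, hall⟩

/-- **With the temperature floor, the Navier–Stokes Type-I dichotomy is equivalent to attainment.**
(`→`: the coldest ceiling `m*` lies below every admissible one; `←`: if some ceiling is admissible, the
infimum `m*` of the admissible ones is `≥ c_Leray > 0` by `exists_typeIFloor`, every larger ceiling is
admissible by monotonicity, and `m*` itself by attainment.) [cite: Leray1934, §19 (3.9)] -/
theorem nsDichotomy_iff_nsAttained : nsDichotomy ↔ nsAttained := by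
  constructor
  · rintro (hnone | ⟨m, hm, hiff⟩) K hK hall
    · exact absurd (hall (K + 1) (by linarith)) (hnone _)
    · exact (hiff K).2 (le_of_forall_gt_imp_ge_of_dense fun M hM => (hiff M).1 (hall M hM))
  · intro hA
    by_cases hex : ∃ M : ℝ, nsTypeI[M]
    · right
      obtain ⟨c, hc, hfloor⟩ := exists_typeIFloor
      set K : Set ℝ := {M : ℝ | nsTypeI[M]} with hK
      have hne : K.Nonempty := hex
      have hbdd : BddBelow K := ⟨c, fun M hM => hfloor M hM⟩
      have hpos : 0 < sInf K := lt_of_lt_of_le hc (le_csInf hne fun M hM => hfloor M hM)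
      have habove : ∀ M : ℝ, sInf K < M → nsTypeI[M] := fun M hM => by
        obtain ⟨M', hM'K, hM'M⟩ := exists_lt_of_csInf_lt hne hM
        exact nsTypeI_mono hM'M.le hM'K
      refine ⟨sInf K, hpos, fun M => ⟨fun hM => csInf_le hbdd hM, fun hle => ?_⟩⟩
      rcases hle.eq_or_lt with heq | hlt
      · rw [← heq]
        exact hA _ hpos habove
      · exact habove M hlt
    · exact Or.inl fun M hM => hex ⟨M, hM⟩

/-- **At a form-zero datum the crux IS `¬ TypeIInfimumNotAttainedNS`.** For every averaging datum with
identically vanishing form (e.g. the zero datum of `exists_form_eq_zero`, symmetric and cancelling): all its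
bounded-temperature blow-up sets are closed iff the infimal Type-I constant of Schwartz-data `H¹⁰_df`-mild
Navier–Stokes blow-ups is attained whenever it is finite. So the disprover's negative lemma
`boundedTemperatureClosed_false_of_typeIInfimumNotAttainedNS` is sharp at the zero datum, and any proof of
the crux as quantified (`∀ 𝒜 ∀ M`) proves exactly this registered open statement there.
[cite: RusinSverak2011, §1 question (Q)] -/
theorem isClosed_btSet_iff_not_typeIInfimumNotAttainedNS {𝒜 : AveragingDatum}
    (h0 : ∀ u v w : L2C, 𝒜.form u v w = 0) :
    (∀ M : ℝ, IsClosed btSet[𝒜, M]) ↔ ¬ TypeIInfimumNotAttainedNS :=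
  (isClosed_btSet_zeroDatum_iff h0).trans
    (nsDichotomy_iff_nsAttained.trans nsAttained_iff_not_typeIInfimumNotAttainedNS)

/-- **The registered stub `stub_attain` of line `Sketch`, read at a form-zero datum, is
`¬ TypeIInfimumNotAttainedNS`.** (`→`: at `θ = 1` the stub is attainment verbatim. `←`: if `θ ∈ S_{M+η}`
for all `η > 0` then `θ > 0`, `nsTypeI[θ(M+η)]` for all `η > 0`, the limiting ceiling `θM` is `≥ c_Leray > 0`
by the floor, every ceiling above it is admissible, so `θM` is admissible by attainment, i.e. `θ ∈ S_M`.)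
Together with `closure_btSet_subset_of_form_eq_zero`: at the obstruction the LOSSY half of the line is a
theorem and the ATTAIN half is the whole open problem. [cite: RusinSverak2011, §1 question (Q)] -/
theorem attain_iff_not_typeIInfimumNotAttainedNS {𝒜 : AveragingDatum}
    (h0 : ∀ u v w : L2C, 𝒜.form u v w = 0) :
    (∀ M θ : ℝ, (∀ η : ℝ, 0 < η → θ ∈ btSet[𝒜, M + η]) → θ ∈ btSet[𝒜, M]) ↔
      ¬ TypeIInfimumNotAttainedNS := by
  rw [← nsAttained_iff_not_typeIInfimumNotAttainedNS]
  constructor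
  · intro hA K hK hall
    have h1 : (1 : ℝ) ∈ btSet[𝒜, K] := by
      refine hA K 1 fun η hη => (mem_btSet_iff_of_form_eq_zero h0 one_pos le_rfl (K + η)).2 ?_
      rw [one_mul]
      exact hall _ (by linarith)
    have h2 := (mem_btSet_iff_of_form_eq_zero h0 one_pos le_rfl K).1 h1
    rwa [one_mul] at h2
  · intro hA M θ hθ
    obtain ⟨c, hc, hfloor⟩ := exists_typeIFloor
    have hθ1 : θ ∈ btSet[𝒜, M + 1] := hθ 1 one_pos
    have hθpos : 0 < θ := by
      rcases hθ1.1.1.eq_or_lt with hz | hpos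
      · exact absurd (by rwa [← hz] at hθ1) (zero_not_mem_btSet_of_form_eq_zero h0 (M + 1))
      · exact hpos
    have hθle : θ ≤ 1 := hθ1.1.2
    have hns : ∀ η : ℝ, 0 < η → nsTypeI[θ * (M + η)] := fun η hη =>
      (mem_btSet_iff_of_form_eq_zero h0 hθpos hθle (M + η)).1 (hθ η hη)
    -- the limiting ceiling `θM` is positive (floor) …
    have hcm : c ≤ θ * M := by
      refine le_of_forall_pos_le_add fun ε hε => ?_
      have h := hfloor _ (hns (ε / θ) (div_pos hε hθpos))
      have heq : θ * (M + ε / θ) = θ * M + ε := by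
        field_simp
      linarith
    have hm : 0 < θ * M := lt_of_lt_of_le hc hcm
    -- … and every strictly larger ceiling is admissible
    refine (mem_btSet_iff_of_form_eq_zero h0 hθpos hθle M).2 (hA _ hm fun M' hM' => ?_)
    have hη : 0 < M' / θ - M := by
      rw [sub_pos, lt_div_iff₀ hθpos]
      linarith [mul_comm θ M]
    have h := hns (M' / θ - M) hη
    have heq : θ * (M + (M' / θ - M)) = M' := by
      field_simp
      ring
    rwa [heq] at h

end Summit.NavierStokesRegularity.NavierStokesRegularity.Theorems.BoundedTemperatureClosed.Negative

end
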